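import Summits.Schanuel.Schanuel.Theorems.ZilberEacParamFibreCurveZerosPos
import Summits.Schanuel.Schanuel.Theorems.ZilberEacParamFibreCurveGrowthSub
import Summits.Schanuel.Schanuel.Theorems.ZilberEacParamFibreCurve
import HarnessLib

/-!
# Polynomially parametrised base curves, XXXI: fibre curves over a polynomial curve in the
# VANISHING-PHASE class — density from the sub-leading order

HONEST FRAMING.  Cell `pub-schanuel` (Zilber's Exponential-Algebraic Closedness, case ladder;
host summit Schanuel), seat 2, gen 20.  File XXI decided Mantova–Masser's density question for
`S(g; Q) = {(g₀(t), g₁(t), y₀, y₁) : Q(t, y₀) = 0}`, `Q ∈ ℂ[t, y₀]`, under the phase condition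
`d ∤ n ∨ Re(lc(g₁)(i/lc(g₀))^{n/d}) ≠ 0` (`d = deg g₀ ≥ 2`, `n = deg g₁`).  Here: the
complementary VANISHING-PHASE class `d ∣ n`, `Re(lc(g₁)(i/lc(g₀))^{n/d}) = 0`, at the next order.
THEOREM (`unprojectedDense_paramSurface₃_of_y0_subleading`): if moreover the sub-leading
coefficients are not in the ratio `n : d`,

  `d · lc(g₀) · (g₁)_{n-1} ≠ n · lc(g₁) · (g₀)_{d-1}`,

and `Q ∈ ℂ[t, y₀]` is irreducible with two `y₀`-degrees, then the exponential points of `S(g; Q)`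
are Zariski dense.  PROOF: the zeros `t_k` of `Q(t, e^{g₀(t)})` on a root direction `ω` satisfy
`t_k = (n_k + 1) ω + τ + o(1)`, `τ = -(g₀)_{d-1}/(d lc(g₀))` (file XXIX); along them
`Re g₁(t_k) = ρ^n Re(lc(g₁)ω^n) + ρ^{n-1} Re(((g₁)_{n-1} + n lc(g₁) τ) ω^{n-1}) + O(ρ^{n-2})`, the
first term VANISHES on every root direction (the phase is zero), and since `d ∤ n - 1` a root
direction with non-vanishing second coefficient exists (gen 19's `exists_rootDirection_re_neg_of_not_dvd`)
exactly when `(g₁)_{n-1} + n lc(g₁) τ ≠ 0`, i.e. under the displayed condition; THEOREM G in `x₁`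
(file XXX) finishes.  Notably this covers EQUAL degrees with REAL leading ratio `λ` as soon as
`(g₁)_{n-1} ≠ λ (g₀)_{n-1}` ("curved real lines", e.g. `(t², √2 t² + t)`), where straight real lines
needed the real-line technology of gens 10–18.  What stays OPEN: `d lc(g₀)(g₁)_{n-1} = n lc(g₁)(g₀)_{d-1}`
with vanishing phase (the next Puiseux orders; e.g. `(t², i t⁴)`, a graph `x₁ = i x₀²`, is gen 18's
degenerate graph class), general algebraic base curves, Fib(3,2), EC(3,2).  Mantova–Masser's
question is OPEN in general (PLMS 2024 §1 p. 5); NOT Schanuel's conjecture (neither used nor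
implied; EAC ⇏ SC).
-/

noncomputable section

open Filter Topology Metric Set Complex MvPolynomial
open Literature.NumberTheory.Transcendental Literature.ModelTheory.Zilber
open Literature.ModelTheory.ExponentialFields

set_option linter.dupNamespace false

namespace Summit.Schanuel.Schanuel.Theorems

/-! ## Part A. Escaping exponential points at the sub-leading order -/

/-- `d ≥ 2`, `d ∣ n`, `n ≥ 1` ⟹ `d ∤ n - 1`. -/
theorem not_dvd_pred_of_dvd {d n : ℕ} (hd : 2 ≤ d) (hn : 1 ≤ n) (hdn : d ∣ n) : ¬ d ∣ (n - 1) := by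
  intro h
  have h1 : d ∣ n - (n - 1) := Nat.dvd_sub hdn h
  rw [show n - (n - 1) = 1 by omega] at h1
  have := Nat.le_of_dvd one_pos h1
  omega

/-- **Zeros of `Q(t, e^{g₀(t)})` located to `o(1)`, with escape of `g₁` at the sub-leading order.**
`deg g₀ = d ≥ 2`, `deg g₁ = n ≥ 2`, `Q ∈ ℂ[t, y₀]` with two monomials of different `y₀`-degree,
`ω` a root direction of `lc(g₀) X^d` with VANISHING phase `Re(lc(g₁) ω^n) = 0` and non-vanishing
second coefficient `Re(((g₁)_{n-1} + n lc(g₁) τ) ω^{n-1}) ≠ 0`, `τ = -(g₀)_{d-1}/(d lc(g₀))`.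
Then there are `t_k` with `Q(t_k; e^{g₀(t_k)}, e^{g₁(t_k)}) = 0` and
`|Re g₁(t_k)|/log(2 + ‖g₁(t_k)‖) → ∞`. (new) -/
theorem exists_paramSurface_expPoints_of_y0_subleading (g₀ g₁ : Polynomial ℂ)
    (hd : 2 ≤ g₀.natDegree) (hn : 2 ≤ g₁.natDegree) (Q : MvPolynomial (Fin 3) ℂ)
    (hQ2 : ∀ m ∈ Q.support, m 2 = 0) (h1 : ∃ m ∈ Q.support, ∃ m' ∈ Q.support, m 1 ≠ m' 1)
    {ω : ℂ} {σ : ℤ} (hσ : σ = 1 ∨ σ = -1)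
    (hω : g₀.leadingCoeff * ω ^ g₀.natDegree = 2 * Real.pi * I * σ)
    (hre0 : (g₁.leadingCoeff * ω ^ g₁.natDegree).re = 0)
    (hc : ((g₁.coeff (g₁.natDegree - 1) + g₁.natDegree * g₁.leadingCoeff *
      (-(g₀.coeff (g₀.natDegree - 1) / (g₀.natDegree * g₀.leadingCoeff)))) *
        ω ^ (g₁.natDegree - 1)).re ≠ 0) :
    ∃ t : ℕ → ℂ, (∀ k, MvPolynomial.eval ![t k, exp (g₀.eval (t k)), exp (g₁.eval (t k))] Q = 0) ∧
      Tendsto (fun k => |(g₁.eval (t k)).re| / Real.log (2 + ‖g₁.eval (t k)‖)) atTop atTop := by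
  classical
  -- coefficient polynomials and exponents (as in file XXI)
  set q : (Fin 3 →₀ ℕ) → Polynomial ℂ := fun m =>
    Polynomial.C (Q.coeff m) * Polynomial.X ^ (m 0) with hq_def
  set e : (Fin 3 →₀ ℕ) → ℕ := fun m => m 1 with he_def
  have hq_deg : ∀ m ∈ Q.support, (q m).natDegree = m 0 := fun m hm =>
    Polynomial.natDegree_C_mul_X_pow _ _ (MvPolynomial.mem_support_iff.1 hm)
  have hq_lc : ∀ m, (q m).leadingCoeff = Q.coeff m := fun m =>
    Polynomial.leadingCoeff_C_mul_X_pow _ _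
  obtain ⟨μ, κ, hκ, ma, hma, mc, hmc, hjne, hja, hjc⟩ := exists_upper_edge Q.support e
    (fun m => m 0) h1
  have hκ' : ∀ m ∈ Q.support, ((q m).natDegree : ℝ) + μ * e m ≤ κ := fun m hm => by
    rw [hq_deg m hm]; exact hκ m hm
  set Jt := Q.support.filter (fun m => ((q m).natDegree : ℝ) + μ * e m = κ) with hJt
  set Qμ : Polynomial ℂ := ∑ m ∈ Jt, Polynomial.C (q m).leadingCoeff * Polynomial.X ^ (e m)
    with hQμ
  have hmem_top : ∀ {m}, m ∈ Q.support → ((m 0 : ℝ) + μ * e m = κ) → m ∈ Jt := fun {m} hm h =>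
    Finset.mem_filter.2 ⟨hm, by rw [hq_deg m hm]; exact h⟩
  have hmaT : ma ∈ Jt := hmem_top hma hja
  have hmcT : mc ∈ Jt := hmem_top hmc hjc
  have hinj : ∀ m ∈ Jt, ∀ m' ∈ Jt, e m = e m' → m = m' := by
    intro m hm m' hm' hee
    obtain ⟨hmM, hmt⟩ := Finset.mem_filter.1 hm
    obtain ⟨hm'M, hm't⟩ := Finset.mem_filter.1 hm'
    have h0eq : m 0 = m' 0 := by
      rw [hq_deg m hmM] at hmt; rw [hq_deg m' hm'M] at hm't
      rw [hee] at hmt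
      have : (m 0 : ℝ) = m' 0 := by linarith
      exact_mod_cast this
    have h1eq : m 1 = m' 1 := hee
    have h2eq : m 2 = m' 2 := by rw [hQ2 m hmM, hQ2 m' hm'M]
    ext i
    fin_cases i
    · exact h0eq
    · exact h1eq
    · exact h2eq
  have hcoeff : ∀ m₁ ∈ Jt, Qμ.coeff (e m₁) = Q.coeff m₁ := by
    intro m₁ hm₁
    rw [hQμ, Polynomial.finsetSum_coeff, Finset.sum_eq_single m₁]
    · rw [Polynomial.coeff_C_mul, Polynomial.coeff_X_pow, if_pos rfl, mul_one, hq_lc]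
    · intro m hm hne
      rw [Polynomial.coeff_C_mul, Polynomial.coeff_X_pow, if_neg, mul_zero]
      exact fun h => hne (hinj m hm m₁ hm₁ h.symm)
    · intro h; exact (h hm₁).elim
  have hca : Qμ.coeff (e ma) ≠ 0 := by
    rw [hcoeff ma hmaT]; exact MvPolynomial.mem_support_iff.1 hma
  have hcc : Qμ.coeff (e mc) ≠ 0 := by
    rw [hcoeff mc hmcT]; exact MvPolynomial.mem_support_iff.1 hmc
  obtain ⟨θ, hθ0, hθ⟩ : ∃ θ : ℂ, θ ≠ 0 ∧ Qμ.eval θ = 0 := by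
    rcases lt_or_gt_of_ne hjne with hlt | hgt
    · exact exists_root_ne_zero_of_coeff_ne_zero (e mc) Qμ (e ma) hlt hca hcc
    · exact exists_root_ne_zero_of_coeff_ne_zero (e ma) Qμ (e mc) hgt hcc hca
  have hQ : Qμ ≠ 0 := fun h => hca (by rw [h, Polynomial.coeff_zero])
  -- located zeros
  obtain ⟨t, ns, hns, ht, hpos⟩ := exists_zeros_log_dir_pos g₀ hd Q.support q e μ κ hκ' hθ0 hθ hQ
    ω σ hσ hω
  refine ⟨t, fun k => ?_, ?_⟩
  · rw [eval₃_eq_sum_coeffPoly_of_y0 Q hQ2]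
    have h := ht k
    simpa only [hq_def, he_def, ← Complex.exp_nat_mul, Polynomial.eval_mul, Polynomial.eval_C,
      Polynomial.eval_pow, Polynomial.eval_X] using h
  · -- growth at the sub-leading order
    have hρ : Tendsto (fun k => ((ns k : ℝ)) + 1) atTop atTop :=
      tendsto_atTop_add_const_right _ _ (tendsto_natCast_atTop_atTop.comp hns)
    refine tendsto_growth_eval_of_subleading g₁ hn ω _ hre0 hc hρ ?_
    refine hpos.congr fun k => ?_
    rw [natCast_add_one_eq_ofReal]

/-! ## Part B. The density theorems in the vanishing-phase class -/

section Main

variable (g₀ g₁ : Polynomial ℂ) {Q : MvPolynomial (Fin 3) ℂ}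

/-- **MAIN THEOREM (fibre curves over a polynomial curve, vanishing phase, sub-leading order).**
`d = deg g₀ ≥ 2`, `n = deg g₁ ≥ 1`, `d ∣ n`, `Re(lc(g₁)(i/lc(g₀))^{n/d}) = 0` (the phase VANISHES),
and `d · lc(g₀) · (g₁)_{n-1} ≠ n · lc(g₁) · (g₀)_{d-1}`; `Q ∈ ℂ[t, y₀]` (no `y₁`) irreducible with two
monomials of different `y₀`-degree ⟹ the exponential points of
`S(g; Q) = {(g₀(t), g₁(t), y₀, y₁) : Q(t, y₀) = 0}` are Zariski dense.
[cite: MantovaMasser2023, §1 Further remarks, p. 5 (the question, open in general)] (new) -/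
theorem unprojectedDense_paramSurface₃_of_y0_subleading (hd : 2 ≤ g₀.natDegree)
    (hn : 1 ≤ g₁.natDegree) (hdvd : g₀.natDegree ∣ g₁.natDegree)
    (hph0 : (g₁.leadingCoeff * (I / g₀.leadingCoeff) ^ (g₁.natDegree / g₀.natDegree)).re = 0)
    (hsub : (g₀.natDegree : ℂ) * g₀.leadingCoeff * g₁.coeff (g₁.natDegree - 1) ≠
      (g₁.natDegree : ℂ) * g₁.leadingCoeff * g₀.coeff (g₀.natDegree - 1))
    (hirr : Irreducible Q) (hQ2 : ∀ m ∈ Q.support, m 2 = 0)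
    (h1 : ∃ m ∈ Q.support, ∃ m' ∈ Q.support, m 1 ≠ m' 1) :
    UnprojectedDense {w : Fin 2 ⊕ Fin 2 → ℂ | ∃ t : ℂ, w (Sum.inl 0) = g₀.eval t ∧
      w (Sum.inl 1) = g₁.eval t ∧
      MvPolynomial.eval (Fin.cases t (fun i => w (Sum.inr i)) : Fin 3 → ℂ) Q = 0} := by
  have hg₀ : 1 ≤ g₀.natDegree := by omega
  have hg0 : g₀ ≠ 0 := by rintro rfl; rw [Polynomial.natDegree_zero] at hd; omega
  have ha0 : g₀.leadingCoeff ≠ 0 := Polynomial.leadingCoeff_ne_zero.2 hg0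
  have hdC : (g₀.natDegree : ℂ) ≠ 0 := Nat.cast_ne_zero.2 (by omega)
  have hnd : g₀.natDegree ≤ g₁.natDegree := Nat.le_of_dvd (by omega) hdvd
  have hn2 : 2 ≤ g₁.natDegree := le_trans hd hnd
  -- the second coefficient
  set c : ℂ := g₁.coeff (g₁.natDegree - 1) + g₁.natDegree * g₁.leadingCoeff *
    (-(g₀.coeff (g₀.natDegree - 1) / (g₀.natDegree * g₀.leadingCoeff))) with hc_def
  have hc0 : c ≠ 0 := by
    intro h0
    apply hsub
    have h2 : (g₀.natDegree : ℂ) * g₀.leadingCoeff * c = 0 := by rw [h0, mul_zero]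
    rw [hc_def] at h2
    field_simp at h2
    linear_combination h2
  obtain ⟨ω, σ, hσ, hω, hre⟩ := exists_rootDirection_re_neg_of_not_dvd g₀.leadingCoeff c ha0 hc0
    hd (not_dvd_pred_of_dvd hd hn hdvd)
  have hre0 : (g₁.leadingCoeff * ω ^ g₁.natDegree).re = 0 := by
    rw [re_mul_rootDirection_pow_of_dvd ha0 (by omega) hdvd hω, hph0, mul_zero]
  obtain ⟨t, ht, hgr⟩ := exists_paramSurface_expPoints_of_y0_subleading g₀ g₁ hd hn2 Q hQ2 h1
    hσ hω hre0 (by rw [← hc_def]; exact hre.ne)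
  exact unprojectedDense_paramSurface₃_of_expPoints₁ g₀ g₁ Q ht hgr
    (isIrreducibleClosed_paramSurface₃ g₀ g₁ hg₀ hirr)
    (by rw [zariskiDim_paramSurface₃ g₀ g₁ hg₀ hirr])

/-- **Independence for equal degrees from the sub-leading coefficients.**  If
`deg g₀ = deg g₁ = n ≥ 2` and `lc(g₀) (g₁)_{n-1} ≠ lc(g₁) (g₀)_{n-1}`, then no relation
`m₀ g₀ + m₁ g₁ = c` with `m ∈ ℤ² ∖ 0` holds. (new) -/
theorem paramCurve_indep_of_subleading (hd : 2 ≤ g₀.natDegree) (heq : g₁.natDegree = g₀.natDegree)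
    (hsub : g₀.leadingCoeff * g₁.coeff (g₁.natDegree - 1) ≠
      g₁.leadingCoeff * g₀.coeff (g₀.natDegree - 1))
    (m : Fin 2 → ℤ) (hm : m ≠ 0) (c : ℂ) :
    Polynomial.C (m 0 : ℂ) * g₀ + Polynomial.C (m 1 : ℂ) * g₁ ≠ Polynomial.C c := by
  intro h
  set n := g₀.natDegree with hn
  have hn1 : g₁.natDegree - 1 = n - 1 := by rw [heq]
  rw [hn1] at hsub
  -- coefficients of `t^n` and `t^{n-1}`
  have htop := congrArg (fun p => p.coeff n) h
  have hsubc := congrArg (fun p => p.coeff (n - 1)) h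
  simp only [Polynomial.coeff_add, Polynomial.coeff_C_mul, Polynomial.coeff_C] at htop hsubc
  rw [if_neg (by omega : n ≠ 0)] at htop
  rw [if_neg (by omega : n - 1 ≠ 0)] at hsubc
  have hlc0 : g₀.coeff n = g₀.leadingCoeff := by rw [Polynomial.leadingCoeff, hn]
  have hlc1 : g₁.coeff n = g₁.leadingCoeff := by rw [Polynomial.leadingCoeff, heq]
  rw [hlc0, hlc1] at htop
  -- the `2 × 2` system has nonzero determinant
  have hm0 : (m 0 : ℂ) = 0 := by
    have e1 : (m 0 : ℂ) * (g₀.leadingCoeff * g₁.coeff (n - 1) - g₁.leadingCoeff * g₀.coeff (n - 1)) =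
        0 := by linear_combination g₁.coeff (n - 1) * htop - g₁.leadingCoeff * hsubc
    exact (mul_eq_zero.1 e1).resolve_right (sub_ne_zero.2 hsub)
  have hm1 : (m 1 : ℂ) = 0 := by
    have e1 : (m 1 : ℂ) * (g₀.leadingCoeff * g₁.coeff (n - 1) - g₁.leadingCoeff * g₀.coeff (n - 1)) =
        0 := by linear_combination g₀.leadingCoeff * hsubc - g₀.coeff (n - 1) * htop
    exact (mul_eq_zero.1 e1).resolve_right (sub_ne_zero.2 hsub)
  apply hm
  funext i
  fin_cases i
  · exact_mod_cast hm0
  · exact_mod_cast hm1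

/-- **Mantova–Masser's question in the vanishing-phase class: case ∧ dense.**  As the main
theorem, plus a nonzero fibre root over infinitely many `t`; then `S(g; Q)` is in the case
(dim-π-S-1-free) AND its exponential points are Zariski dense.  (For `deg g₀ = deg g₁` the
hypothesis reads `lc(g₀)(g₁)_{n-1} ≠ lc(g₁)(g₀)_{n-1}`, and independence of the base curve
follows from it.) [cite: MantovaMasser2023, §1 Further remarks, p. 5 (the question, open in
general)] (new) -/
theorem unprojectedDensityQuestion_instance_paramSurface₃_of_y0_subleading (hd : 2 ≤ g₀.natDegree)
    (hn : 1 ≤ g₁.natDegree) (hdvd : g₀.natDegree ∣ g₁.natDegree)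
    (hph0 : (g₁.leadingCoeff * (I / g₀.leadingCoeff) ^ (g₁.natDegree / g₀.natDegree)).re = 0)
    (hsub : (g₀.natDegree : ℂ) * g₀.leadingCoeff * g₁.coeff (g₁.natDegree - 1) ≠
      (g₁.natDegree : ℂ) * g₁.leadingCoeff * g₀.coeff (g₀.natDegree - 1))
    (hirr : Irreducible Q) (hQ2 : ∀ m ∈ Q.support, m 2 = 0)
    (h1 : ∃ m ∈ Q.support, ∃ m' ∈ Q.support, m 1 ≠ m' 1)
    (hfib : Set.Infinite {t : ℂ | ∃ y : ℂ, y ≠ 0 ∧ MvPolynomial.eval ![t, y, 1] Q = 0}) :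
    MMCaseDimPiOneFree {w : Fin 2 ⊕ Fin 2 → ℂ | ∃ t : ℂ, w (Sum.inl 0) = g₀.eval t ∧
        w (Sum.inl 1) = g₁.eval t ∧
        MvPolynomial.eval (Fin.cases t (fun i => w (Sum.inr i)) : Fin 3 → ℂ) Q = 0} ∧
      UnprojectedDense {w : Fin 2 ⊕ Fin 2 → ℂ | ∃ t : ℂ, w (Sum.inl 0) = g₀.eval t ∧
        w (Sum.inl 1) = g₁.eval t ∧
        MvPolynomial.eval (Fin.cases t (fun i => w (Sum.inr i)) : Fin 3 → ℂ) Q = 0} := by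
  refine ⟨mmCase_paramSurface₃_of_y0 g₀ g₁ (by omega) ?_ hirr hfib,
    unprojectedDense_paramSurface₃_of_y0_subleading g₀ g₁ hd hn hdvd hph0 hsub hirr hQ2 h1⟩
  by_cases hne : g₀.natDegree = g₁.natDegree
  · refine paramCurve_indep_of_subleading g₀ g₁ hd hne.symm ?_
    intro h
    apply hsub
    rw [← hne] at h ⊢
    rw [mul_assoc, mul_assoc, h]
  · exact paramCurve_indep_of_ne g₀ g₁ (by omega) hn hne

end Main

end Summit.Schanuel.Schanuel.Theorems
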